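import Literature.AlgebraicGeometry.Motives.HodgeStructurePicardNumberPowers
import Literature.AlgebraicGeometry.Motives.HodgeStructureHodgeClassesFinrank
import Literature.AlgebraicGeometry.Motives.HodgeStructureK3TypeRankTwo
import Literature.AlgebraicGeometry.Motives.HodgeGroupCommutativeIffCM
import HarnessLib

/-!
# Hulek–Laface 2019, Cor. 2.6 on the abstract carrier: an effective polarized weight-one `ℚ`-Hodge structure `E` with
# `h^{1,0} = 1` is irreducible with `dim E_φ(E) ∈ {1, 2}`, `ρ(E) = 1` and `ρ(E^{⊕k}) ∈ {C(k+1, 2), k²}` (no CM / CM read off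
# `dim E_φ`); §3.2 Case (b), `m = 1`: `ρ(E^{⊕g}) ≤ (g−1)² + 1` or `= g²` for `g ≥ 4`; and a type-free Cor. 2.5,
# `ρ(B^{⊕k}) ≤ dim V · C(k+1, 2)`, for every irreducible polarized `B` of odd weight

[topic AlgebraicGeometry/Motives]

Layer `Literature/AlgebraicGeometry/Motives`, lane `lit-hodgefound` (Track 2 foundations library; prover seat `lit-hodgefound-p34`,
generation 28, row g28-#3). THEOREMS ONLY (no `def`, no named fact, no instance, no notation; net debt `0`). Companion of the seat's
g28-#2 `Motives/HodgeStructurePicardNumberSimplexBound`, built on g26-#8 `Motives/HodgeStructurePicardNumberPowers` (Murty's Lemma 3.3 in the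
uniform form `ρ(H^{⊕ι}) = |ι| ρ(H) + C(|ι|, 2) dim E_φ(H)`, and `ρ(H^{⊕k}) = C(k+1, 2)` / `k²` GIVEN `E_φ = ℚ` / `ρ = 1, dim E_φ = 2`),
g26-#3 `Motives/HodgeStructurePicardNumberSymmetricEndomorphisms` (`1 ≤ ρ(H) ≤ dim E_φ(H)`), `Motives/HodgeStructureHodgeClassesFinrank`
(`ρ ≤ g²`) and `Motives/HodgeGroupCommutativeIffCM` (`IsIrreducible.finrank_endAlg_le`: `dim E_φ ≤ dim V` for irreducible `H`). Here the
hypotheses of g26-#8's two values are DERIVED from `h^{1,0}(E) = 1`.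

POSITION IN THE TREE. On COMPLEX TORI / abelian varieties (the Kähler layer, carrier `ComplexTorus`) the lane already has the whole of
Hulek–Laface §2–§3: Cor. 2.6 (`Geometry/Kaehler/ComplexTorusPicardNumberEllipticPower`), Cor. 2.3 / Prop. 3.1 / Cor. 3.2 / Remark 3.3
along Poincaré decompositions (`…PicardNumberPoincareLength`), Cor. 2.5 even without Albert's classification (`…PicardNumberSimpleBound`),
Thm. 1.1 (1) for elliptic products (`…PicardNumberFirstGap`) and Thm. 1.1 (1), (2), Thm. 4.2 for every abelian variety
(`…PicardNumberGapsGeneral`). The present file is the counterpart on the ABSTRACT carrier (a `ℚ`-Hodge structure `Motives.HodgeStructure`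
with a `Polarization`, direct sums `HodgeStructure.pi`), which does not import the Kähler layer; it covers only what the carrier's
present vocabulary gives without Albert types (so Case (b) with `m ≥ 2` of Thm. 1.1 (1) is NOT here).

## The source, verbatim

K. Hulek, R. Laface, *On the Picard numbers of abelian varieties* (2019) [HulekLaface2019PicardNumbersAV] (held text
`paper:arxiv-1703.05882`). Chunk p0006, **Corollary 2.5.** "Let `A` be a simple abelian variety of dimension `n`, and let `k ≥ 1`. Then
`ρ(A^k) ≤ ½ n k (2k+1)`." **Corollary 2.6.** "If `E` is an elliptic curve, then `ρ(E^k) = ½ k(k+1)` (`E` has no CM), `k²` (`E` has CM)."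
Chunk p0007, §3.2 (proof of **Thm. 1.1 (1)**: "Fix `g ≥ 4`. There does not exist any abelian variety of dimension `g` with Picard number
`ρ` in the following range: `(g−1)² + 1 < ρ < g²`"), "Case (b). Let `B` be an `m`-dimensional simple abelian variety, and suppose `A` is
isogenous to `B^k`, for `k := g/m`. If `m = 1` (i.e. `B` is an elliptic curve), then again by Corollary 2.6 `ρ(B^g) = C(g+1, 2)` (`B` has
no CM), `g²` (`B` has CM). If `B` has CM, then `A` attains the maximal Picard number `g²`; if `B` does not have CM, then
`ρ(A) = C(g+1, 2) ≤ 1 + (g−1)²` because `g ≥ 4`."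

## Reading on the carrier, and what is PROVED

"Elliptic curve" = effective weight-one `E` with `h^{1,0}(E) = 1` (rank `2`); "simple" = `IsIrreducible` (no sub-Hodge structures but `0`
and `V`); `E_φ(H) = H.endAlg`; `ρ(H) = dim_ℚ Hdgⁿ(⋀² H)`; `H^{⊕ι} = HodgeStructure.pi (fun _ : ι ↦ H)`, `k = |ι|`; "CM / no CM" for `E`
= `dim E_φ(E) = 2 / 1`.

* §1 **ELLIPTIC CURVES ON THE CARRIER**: an effective weight-one `E` with `h^{1,0} = 1` has `dim V = 2` and is IRREDUCIBLE
  (`isIrreducible_of_hodgeNumber_eq_one`: a sub-Hodge structure is effective of weight one, so of even rank `2 h^{1,0}`), hence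
  `dim E_φ(E) ≤ 2`; with a polarization `ρ(E) = 1` and `dim E_φ(E) ∈ {1, 2}`; `ρ(E^{⊕k}) = k + C(k, 2) dim E_φ(E)`;
  **COR. 2.6: `ρ(E^{⊕k}) = C(k+1, 2)` or `= k²`** (`Polarization.finrank_hodgeClasses_two_pi_const_eq_choose_or_eq_sq`), with, for `k ≥ 2`,
  `ρ(E^{⊕k}) = k² ⟺ dim E_φ(E) = 2` and `ρ(E^{⊕k}) = C(k+1, 2) ⟺ dim E_φ(E) = 1` (CM read off the Picard number of a power);
  **THM. 1.1 (1), CASE (b), `m = 1`: `k = g ≥ 4 ⟹ ρ(E^{⊕g}) ≤ (g−1)² + 1` or `ρ(E^{⊕g}) = g²`**.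
* §2 **A TYPE-FREE COR. 2.5 for every irreducible polarized `B` of odd weight: `ρ(B^{⊕k}) ≤ dim V · C(k+1, 2)`** (`ρ(B) ≤ dim E_φ(B) ≤ dim V`
  in Murty's formula); for weight one and `h^{1,0}(B) = m`: `ρ(B^{⊕k}) ≤ m k (k+1)`. This is weaker than the printed `½ m k (2k+1)` by
  `½ m k` (no Albert types on this carrier; on complex tori the sharp bound is `…PicardNumberSimpleBound`).

NOT here: Case (b) with `m ≥ 2`, Thm. 1.1 (1) as a whole, Poincaré reducibility (all on the torus side, see above).

## References

* [HulekLaface2019PicardNumbersAV] K. Hulek, R. Laface, *On the Picard numbers of abelian varieties*, Ann. Sc. Norm. Super. Pisa Cl.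
  Sci. (2019), arXiv:1703.05882 — §2.2 Prop. 2.4, Cor. 2.5, Cor. 2.6; §3.2 Case (b); Thm. 1.1 (1).
* [Murty1984] V. K. Murty, *Exceptional Hodge classes on certain abelian varieties*, Math. Ann. 268 (1984) — Lemma 3.3.
* [Lange2023AbelianVarietiesComplex] H. Lange, *Abelian Varieties over the Complex Numbers* (2023), §1.3.4 Exercise (10) (b), §2.6.1.
* [Huybrechts2016K3] D. Huybrechts, *Lectures on K3 surfaces* (2016), §3.3.3 and Cor. 3.3.6 (irreducible Hodge structures,
  `dim End ≤ dim V`).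
-/

noncomputable section

namespace Literature.AlgebraicGeometry.Motives.HodgeStructure

universe u

/-! ## §1 Elliptic curves on the carrier: rank two, weight one -/

section Elliptic

variable {V : Type u} [AddCommGroup V] [Module ℚ V] [Module.Finite ℚ V] (E : HodgeStructure V 1)

/-- **`h^{1,0}(E) = 1 ⟹ dim_ℚ V = 2`** (effective weight one: `dim V = 2 h^{1,0}`). [cite: Lange2023AbelianVarietiesComplex, §1.3.4 Exercise (10) (b)]
[cite: HulekLaface2019PicardNumbersAV, §1 ("`b_k(A) = C(2g, k)`")] -/
theorem finrank_eq_two_of_hodgeNumber_eq_one (hE : E.IsEffective) (h1 : E.hodgeNumber 1 0 = 1) : Module.finrank ℚ V = 2 := by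
  have h := finrank_eq_two_mul_hodgeNumber_weightOne E hE
  rw [h1] at h
  exact_mod_cast h

/-- **An effective weight-one Hodge structure with `h^{1,0} = 1` is IRREDUCIBLE** ("`B` is an elliptic curve", hence simple): a sub-Hodge
structure is again effective of weight one, so of even rank `2 h^{1,0}`, and `dim V = 2`. [cite: Huybrechts2016K3, §3.3.3]
[cite: HulekLaface2019PicardNumbersAV, §3.2 Case (b) ("`m = 1` (i.e. `B` is an elliptic curve)")] -/
theorem isIrreducible_of_hodgeNumber_eq_one (hE : E.IsEffective) (h1 : E.hodgeNumber 1 0 = 1) : E.IsIrreducible := by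
  have hV : Module.finrank ℚ V = 2 := finrank_eq_two_of_hodgeNumber_eq_one E hE h1
  have hntV : Nontrivial V := Module.nontrivial_of_finrank_pos (R := ℚ) (by omega)
  refine ⟨hntV, fun S ↦ ?_⟩
  have hle : Module.finrank ℚ S.toSubmodule ≤ 2 := hV ▸ Submodule.finrank_le S.toSubmodule
  obtain h0 | h1' | h2 : Module.finrank ℚ S.toSubmodule = 0 ∨ Module.finrank ℚ S.toSubmodule = 1 ∨
      Module.finrank ℚ S.toSubmodule = 2 := by omega
  · exact Or.inl (Submodule.finrank_eq_zero.1 h0)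
  · exfalso
    have hSeff : S.toHodgeStructure.IsEffective := fun p q hne ↦ hE p q fun h ↦ hne (S.piece_eq_bot_of_piece_eq_bot h)
    have h := finrank_eq_two_mul_hodgeNumber_weightOne S.toHodgeStructure hSeff
    rw [h1'] at h
    omega
  · exact Or.inr (Submodule.eq_top_of_finrank_eq (h2.trans hV.symm))

/-- **`dim_ℚ E_φ(E) ≤ 2`** for an effective weight-one `E` with `h^{1,0} = 1` (`E_φ ↪ V` for irreducible `E`): "`End⁰(E)` is `ℚ` or an
imaginary quadratic field". [cite: Huybrechts2016K3, Cor. 3.3.6] [cite: HulekLaface2019PicardNumbersAV, §2.2 Cor. 2.6] -/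
theorem finrank_endAlg_le_two_of_hodgeNumber_eq_one (hE : E.IsEffective) (h1 : E.hodgeNumber 1 0 = 1) :
    Module.finrank ℚ E.endAlg ≤ 2 :=
  ((isIrreducible_of_hodgeNumber_eq_one E hE h1).finrank_endAlg_le E).trans (finrank_eq_two_of_hodgeNumber_eq_one E hE h1).le

variable {E} (Q : Polarization E)

include Q in
/-- **`ρ(E) = 1`** for a polarized effective weight-one `E` with `h^{1,0} = 1` (`1 ≤ ρ ≤ g² = 1`: "`NS(E) ≅ ℤ`").
[cite: HulekLaface2019PicardNumbersAV, §2.1 (after Prop. 2.2: "since `NS(E) ≅ ℤ`")] [cite: Lange2023AbelianVarietiesComplex, §1.3.4 Exercise (10) (b)] -/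
theorem Polarization.finrank_hodgeClasses_two_eq_one_of_hodgeNumber_eq_one (hE : E.IsEffective) (h1 : E.hodgeNumber 1 0 = 1) :
    Module.finrank ℚ ↥((E.exteriorPower 2).hodgeClasses 1) = 1 := by
  haveI : Nontrivial V := Module.nontrivial_of_finrank_pos (R := ℚ) (by rw [finrank_eq_two_of_hodgeNumber_eq_one E hE h1]; norm_num)
  have hle := finrank_hodgeClasses_exteriorPower_two_le E hE
  rw [h1, one_pow] at hle
  exact le_antisymm hle (Q.one_le_finrank_hodgeClasses_two odd_one)

include Q in
/-- **`1 ≤ dim_ℚ E_φ(E) ≤ 2`** (polarized: `1 ≤ ρ(E) ≤ dim E_φ(E)`). [cite: HulekLaface2019PicardNumbersAV, §2.2 Cor. 2.6] -/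
theorem Polarization.finrank_endAlg_eq_one_or_eq_two_of_hodgeNumber_eq_one (hE : E.IsEffective) (h1 : E.hodgeNumber 1 0 = 1) :
    Module.finrank ℚ E.endAlg = 1 ∨ Module.finrank ℚ E.endAlg = 2 := by
  have h2 := finrank_endAlg_le_two_of_hodgeNumber_eq_one E hE h1
  have hρ := Q.finrank_hodgeClasses_two_eq_one_of_hodgeNumber_eq_one hE h1
  have h1' : 1 ≤ Module.finrank ℚ E.endAlg := hρ ▸ Q.finrank_hodgeClasses_two_le_finrank_endAlg odd_one
  omega

include Q in
/-- **`ρ(E^{⊕ι}) = |ι| + C(|ι|, 2) · dim E_φ(E)`** (Murty's uniform formula with `ρ(E) = 1`). [cite: HulekLaface2019PicardNumbersAV, §2.2 Prop. 2.4 and Cor. 2.6]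
[cite: Murty1984, Lemma 3.3] -/
theorem Polarization.finrank_hodgeClasses_two_pi_const_of_hodgeNumber_eq_one (hE : E.IsEffective) (h1 : E.hodgeNumber 1 0 = 1)
    {ι : Type} [Fintype ι] [DecidableEq ι] :
    Module.finrank ℚ ↥(((HodgeStructure.pi fun _ : ι ↦ E).exteriorPower 2).hodgeClasses 1) =
      Fintype.card ι + (Fintype.card ι).choose 2 * Module.finrank ℚ E.endAlg := by
  rw [Q.finrank_hodgeClasses_two_pi_const odd_one, Q.finrank_hodgeClasses_two_eq_one_of_hodgeNumber_eq_one hE h1, mul_one]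

include Q in
/-- **COR. 2.6 ON THE CARRIER: `ρ(E^{⊕k}) = ½ k(k+1)` or `ρ(E^{⊕k}) = k²`** for a polarized effective weight-one `E` with `h^{1,0} = 1`,
according as `E_φ(E)` has dimension `1` ("`E` has no CM") or `2` ("`E` has CM"). [cite: HulekLaface2019PicardNumbersAV, §2.2 Cor. 2.6] -/
theorem Polarization.finrank_hodgeClasses_two_pi_const_eq_choose_or_eq_sq (hE : E.IsEffective) (h1 : E.hodgeNumber 1 0 = 1)
    {ι : Type} [Fintype ι] [DecidableEq ι] :
    Module.finrank ℚ ↥(((HodgeStructure.pi fun _ : ι ↦ E).exteriorPower 2).hodgeClasses 1) = (Fintype.card ι + 1).choose 2 ∨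
      Module.finrank ℚ ↥(((HodgeStructure.pi fun _ : ι ↦ E).exteriorPower 2).hodgeClasses 1) = Fintype.card ι ^ 2 := by
  rw [Q.finrank_hodgeClasses_two_pi_const_of_hodgeNumber_eq_one hE h1]
  have ec : (Fintype.card ι + 1).choose 2 = Fintype.card ι + (Fintype.card ι).choose 2 := by
    rw [Nat.choose_succ_succ' (Fintype.card ι) 1, Nat.choose_one_right]
  have es : Fintype.card ι ^ 2 = Fintype.card ι + (Fintype.card ι).choose 2 * 2 := by
    have h : (Fintype.card ι + 1) * (Fintype.card ι).choose 1 = (Fintype.card ι + 1).choose 2 * 2 :=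
      Nat.add_one_mul_choose_eq (Fintype.card ι) 1
    rw [Nat.choose_one_right, ec, add_mul] at h
    nlinarith [h]
  rcases Q.finrank_endAlg_eq_one_or_eq_two_of_hodgeNumber_eq_one hE h1 with he | he
  · exact Or.inl (by rw [he, mul_one, ec])
  · exact Or.inr (by rw [he, es])

include Q in
/-- **"`E` has CM" read off the Picard number of a power: for `k ≥ 2`, `ρ(E^{⊕k}) = k²` iff `dim E_φ(E) = 2`.**
[cite: HulekLaface2019PicardNumbersAV, §2.2 Cor. 2.6] -/
theorem Polarization.finrank_hodgeClasses_two_pi_const_eq_sq_iff_finrank_endAlg_eq_two (hE : E.IsEffective) (h1 : E.hodgeNumber 1 0 = 1)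
    {ι : Type} [Fintype ι] [DecidableEq ι] (hk : 2 ≤ Fintype.card ι) :
    Module.finrank ℚ ↥(((HodgeStructure.pi fun _ : ι ↦ E).exteriorPower 2).hodgeClasses 1) = Fintype.card ι ^ 2 ↔
      Module.finrank ℚ E.endAlg = 2 := by
  rw [Q.finrank_hodgeClasses_two_pi_const_of_hodgeNumber_eq_one hE h1]
  have ec : (Fintype.card ι + 1).choose 2 = Fintype.card ι + (Fintype.card ι).choose 2 := by
    rw [Nat.choose_succ_succ' (Fintype.card ι) 1, Nat.choose_one_right]
  have es : Fintype.card ι ^ 2 = Fintype.card ι + (Fintype.card ι).choose 2 * 2 := by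
    have h : (Fintype.card ι + 1) * (Fintype.card ι).choose 1 = (Fintype.card ι + 1).choose 2 * 2 :=
      Nat.add_one_mul_choose_eq (Fintype.card ι) 1
    rw [Nat.choose_one_right, ec, add_mul] at h
    nlinarith [h]
  have hpos : 0 < (Fintype.card ι).choose 2 := Nat.choose_pos hk
  rw [es]
  constructor
  · intro h
    exact Nat.eq_of_mul_eq_mul_left hpos (by omega)
  · intro h
    rw [h]

include Q in
/-- **"`E` has no CM" read off the Picard number of a power: for `k ≥ 2`, `ρ(E^{⊕k}) = C(k+1, 2)` iff `E_φ(E) = ℚ` (`dim = 1`).**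
[cite: HulekLaface2019PicardNumbersAV, §2.2 Cor. 2.6] -/
theorem Polarization.finrank_hodgeClasses_two_pi_const_eq_choose_iff_finrank_endAlg_eq_one (hE : E.IsEffective)
    (h1 : E.hodgeNumber 1 0 = 1) {ι : Type} [Fintype ι] [DecidableEq ι] (hk : 2 ≤ Fintype.card ι) :
    Module.finrank ℚ ↥(((HodgeStructure.pi fun _ : ι ↦ E).exteriorPower 2).hodgeClasses 1) = (Fintype.card ι + 1).choose 2 ↔
      Module.finrank ℚ E.endAlg = 1 := by
  have ec : (Fintype.card ι + 1).choose 2 = Fintype.card ι + (Fintype.card ι).choose 2 := by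
    rw [Nat.choose_succ_succ' (Fintype.card ι) 1, Nat.choose_one_right]
  rw [Q.finrank_hodgeClasses_two_pi_const_of_hodgeNumber_eq_one hE h1, ec]
  have hpos : 0 < (Fintype.card ι).choose 2 := Nat.choose_pos hk
  constructor
  · intro h
    exact Nat.eq_of_mul_eq_mul_left hpos (by omega)
  · intro h
    rw [h, mul_one]

include Q in
/-- **THM. 1.1 (1), CASE (b), `m = 1`, ON THE CARRIER: for `k = g ≥ 4`, `ρ(E^{⊕g}) ≤ (g−1)² + 1` or `ρ(E^{⊕g}) = g²`** — "If `B` has CM,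
then `A` attains the maximal Picard number `g²`; if `B` does not have CM, then `ρ(A) = C(g+1, 2) ≤ 1 + (g−1)²` because `g ≥ 4`."
[cite: HulekLaface2019PicardNumbersAV, §3.2 Case (b) and Thm. 1.1 (1)] -/
theorem Polarization.finrank_hodgeClasses_two_pi_const_le_or_eq_sq_of_hodgeNumber_eq_one (hE : E.IsEffective)
    (h1 : E.hodgeNumber 1 0 = 1) {ι : Type} [Fintype ι] [DecidableEq ι] (hg : 4 ≤ Fintype.card ι) :
    Module.finrank ℚ ↥(((HodgeStructure.pi fun _ : ι ↦ E).exteriorPower 2).hodgeClasses 1) ≤ (Fintype.card ι - 1) ^ 2 + 1 ∨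
      Module.finrank ℚ ↥(((HodgeStructure.pi fun _ : ι ↦ E).exteriorPower 2).hodgeClasses 1) = Fintype.card ι ^ 2 := by
  rcases Q.finrank_hodgeClasses_two_pi_const_eq_choose_or_eq_sq hE h1 (ι := ι) with h | h
  · -- "`C(g+1, 2) ≤ 1 + (g−1)²` because `g ≥ 4`": `2(g−1)² + 2 − g(g+1) = (g−1)(g−4) ≥ 0` (on complex tori this is the tree's
    -- `Geometry.Kaehler.ComplexTorus.choose_succ_two_le_sq_pred_add_one`, not importable into this lower layer)
    refine Or.inl (h.le.trans ?_)
    obtain ⟨g, hgι⟩ := Nat.exists_eq_add_of_le' hg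
    rw [hgι]
    have e : (g + 4 + 1) * (g + 4).choose 1 = (g + 4 + 1).choose 2 * 2 := Nat.add_one_mul_choose_eq (g + 4) 1
    rw [Nat.choose_one_right] at e
    have e' : g + 4 - 1 = g + 3 := by omega
    rw [e']
    nlinarith [Nat.zero_le (g * g)]
  · exact Or.inr h

end Elliptic

/-! ## §2 Self-products of an irreducible Hodge structure: a type-free Cor. 2.5 -/

section SelfProducts

variable {V : Type u} [AddCommGroup V] [Module ℚ V] [Module.Finite ℚ V] {n : ℤ} {B : HodgeStructure V n} (Q : Polarization B)

include Q in
/-- **A TYPE-FREE COR. 2.5: `ρ(B^{⊕ι}) ≤ dim_ℚ V · C(|ι|+1, 2)` for an irreducible polarized `B` of odd weight** — Murty's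
`ρ(B^{⊕ι}) = |ι| ρ(B) + C(|ι|, 2) dim E_φ(B)` with `ρ(B) ≤ dim E_φ(B) ≤ dim V` ("simple" ⟹ `E_φ ↪ V`). Cor. 2.5's `½ n k(2k+1)` (`dim V = 2n`)
is sharper by `½ n k`, using Albert's divisibilities through Prop. 2.4. [cite: HulekLaface2019PicardNumbersAV, §2.2 Prop. 2.4 and Cor. 2.5]
[cite: Murty1984, Lemma 3.3] [cite: Huybrechts2016K3, Cor. 3.3.6] -/
theorem Polarization.finrank_hodgeClasses_two_pi_const_le_finrank_mul_choose (hn : Odd n) (hirr : B.IsIrreducible)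
    {ι : Type} [Fintype ι] [DecidableEq ι] :
    Module.finrank ℚ ↥(((HodgeStructure.pi fun _ : ι ↦ B).exteriorPower 2).hodgeClasses n) ≤
      Module.finrank ℚ V * (Fintype.card ι + 1).choose 2 := by
  have hE : Module.finrank ℚ B.endAlg ≤ Module.finrank ℚ V := hirr.finrank_endAlg_le B
  have hρ : Module.finrank ℚ ↥((B.exteriorPower 2).hodgeClasses n) ≤ Module.finrank ℚ V :=
    (Q.finrank_hodgeClasses_two_le_finrank_endAlg hn).trans hE
  have ec : (Fintype.card ι + 1).choose 2 = Fintype.card ι + (Fintype.card ι).choose 2 := by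
    rw [Nat.choose_succ_succ' (Fintype.card ι) 1, Nat.choose_one_right]
  rw [Q.finrank_hodgeClasses_two_pi_const hn, ec, mul_add]
  exact add_le_add (by rw [mul_comm]; exact Nat.mul_le_mul_right _ hρ) (by rw [mul_comm]; exact Nat.mul_le_mul_right _ hE)

end SelfProducts

section SelfProductsWeightOne

variable {V : Type u} [AddCommGroup V] [Module ℚ V] [Module.Finite ℚ V] {B : HodgeStructure V 1} (Q : Polarization B)

include Q in
/-- **Weight one: `ρ(B^{⊕k}) ≤ m k (k+1)` for an irreducible effective polarized `B` with `h^{1,0} = m` (`dim V = 2m`)** — the type-free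
Cor. 2.5 (`½ m k(2k+1)` in print). [cite: HulekLaface2019PicardNumbersAV, §2.2 Cor. 2.5] [cite: Murty1984, Lemma 3.3] -/
theorem Polarization.finrank_hodgeClasses_two_pi_const_le_hodgeNumber_mul (hB : B.IsEffective) (hirr : B.IsIrreducible)
    {ι : Type} [Fintype ι] [DecidableEq ι] :
    Module.finrank ℚ ↥(((HodgeStructure.pi fun _ : ι ↦ B).exteriorPower 2).hodgeClasses 1) ≤
      B.hodgeNumber 1 0 * (Fintype.card ι * (Fintype.card ι + 1)) := by
  have hV : Module.finrank ℚ V = 2 * B.hodgeNumber 1 0 := by exact_mod_cast finrank_eq_two_mul_hodgeNumber_weightOne B hB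
  have h := Q.finrank_hodgeClasses_two_pi_const_le_finrank_mul_choose odd_one hirr (ι := ι)
  rw [hV] at h
  have e : (Fintype.card ι + 1) * (Fintype.card ι).choose 1 = (Fintype.card ι + 1).choose 2 * 2 :=
    Nat.add_one_mul_choose_eq (Fintype.card ι) 1
  rw [Nat.choose_one_right] at e
  calc _ ≤ 2 * B.hodgeNumber 1 0 * (Fintype.card ι + 1).choose 2 := h
    _ = B.hodgeNumber 1 0 * ((Fintype.card ι + 1).choose 2 * 2) := by ring
    _ = B.hodgeNumber 1 0 * (Fintype.card ι * (Fintype.card ι + 1)) := by rw [← e, mul_comm (Fintype.card ι + 1)]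

end SelfProductsWeightOne

end Literature.AlgebraicGeometry.Motives.HodgeStructure

end
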